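import Mathlib

/-!
# A smooth squash of the parameter line which is the identity near `0`

Helper for the tail-gluing reduction of crux `TameExitsLocalise` (stmt-FinalStateConjecture-16894), line `birth`,
stub S1 `stub_parametricTailGluing`: a `C^∞`, injective map `φ : ℝ¹ → ℝ¹` with `‖φ c‖ < δ` for every `c` and
`φ c = c` for `‖c‖ < δ'` (some `0 < δ' < δ`). It folds a curve of data which is only controlled on the window
`‖c‖ < δ` into a globally defined curve WITHOUT changing it near the base parameter (the radial contraction
`exists_contDiff_radialContraction` of `TameGenericityLocal.lean` has differential `ε • id` at `0` and does not
keep the parameter). Construction: the primitive `f s = ∫₀ˢ g` of the smooth profile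
`g σ = 1 − χ(σ² − 1) σ²/(1 + σ²)` (`χ = Real.smoothTransition`), which is `1` on `[-1, 1]`, positive, and
`≤ 3/(1 + σ²)`, so that `f` is smooth, strictly increasing, `= id` on `[-1, 1]` and `|f| ≤ 3|arctan| < 5`;
then rescale by `δ/5` and transport to `ℝ¹ = EuclideanSpace ℝ (Fin 1)`. Everything is folklore calculus; the
file declares no definitions (the two functions are local `set`s).
-/

noncomputable section

set_option linter.dupNamespace false

open Set Filter Function Topology Real
open scoped ContDiff

namespace Summit.FinalStateConjecture.FinalStateConjecture.Theorems.LaminatedThreshold.TailGluing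

/-- **A smooth, strictly increasing, bounded real function which is the identity on `[-1, 1]`**:
`f s = ∫₀ˢ g` with `g σ = 1 − χ(σ² − 1) σ²/(1 + σ²)`, `χ = Real.smoothTransition`; `g` is smooth, `= 1` on
`[-1, 1]`, positive and `≤ 3 (1 + σ²)⁻¹`, whence `|f s| ≤ 3 |arctan s| < 3π/2 < 5`. [folklore] -/
theorem exists_real_squash :
    ∃ f : ℝ → ℝ, ContDiff ℝ ∞ f ∧ StrictMono f ∧ (∀ s, |s| ≤ 1 → f s = s) ∧ ∀ s, |f s| < 5 := by
  -- the profile `g`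
  set g : ℝ → ℝ := fun σ ↦ 1 - Real.smoothTransition (σ ^ 2 - 1) * (σ ^ 2 / (1 + σ ^ 2)) with hg
  have g_smooth : ContDiff ℝ ∞ g := by
    have h1 : ContDiff ℝ ∞ (fun σ : ℝ ↦ σ ^ 2 - 1) := (contDiff_id.pow 2).sub contDiff_const
    have h2 : ContDiff ℝ ∞ (fun σ : ℝ ↦ σ ^ 2 / (1 + σ ^ 2)) :=
      (contDiff_id.pow 2).div (contDiff_const.add (contDiff_id.pow 2)) fun σ ↦ by positivity
    exact contDiff_const.sub ((Real.smoothTransition.contDiff.comp h1).mul h2)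
  have g_one : ∀ σ : ℝ, |σ| ≤ 1 → g σ = 1 := fun σ h ↦ by
    have hσ : σ ^ 2 - 1 ≤ 0 := by
      have h' : |σ| * |σ| ≤ 1 * 1 := mul_le_mul h h (abs_nonneg σ) zero_le_one
      rw [abs_mul_abs_self] at h'
      nlinarith
    simp [hg, Real.smoothTransition.zero_of_nonpos hσ]
  have g_ge : ∀ σ : ℝ, (1 + σ ^ 2)⁻¹ ≤ g σ := fun σ ↦ by
    have hpos : 0 < 1 + σ ^ 2 := by positivity
    have hχ1 := Real.smoothTransition.le_one (σ ^ 2 - 1)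
    have hfrac : 0 ≤ σ ^ 2 / (1 + σ ^ 2) := by positivity
    have hle : Real.smoothTransition (σ ^ 2 - 1) * (σ ^ 2 / (1 + σ ^ 2)) ≤ σ ^ 2 / (1 + σ ^ 2) := by
      calc Real.smoothTransition (σ ^ 2 - 1) * (σ ^ 2 / (1 + σ ^ 2))
          ≤ 1 * (σ ^ 2 / (1 + σ ^ 2)) := mul_le_mul_of_nonneg_right hχ1 hfrac
        _ = σ ^ 2 / (1 + σ ^ 2) := one_mul _
    have hkey : (1 + σ ^ 2)⁻¹ = 1 - σ ^ 2 / (1 + σ ^ 2) := by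
      field_simp
      ring
    rw [hkey, hg]
    linarith
  have g_pos : ∀ σ : ℝ, 0 < g σ := fun σ ↦ lt_of_lt_of_le (by positivity) (g_ge σ)
  have g_le : ∀ σ : ℝ, g σ ≤ 3 * (1 + σ ^ 2)⁻¹ := fun σ ↦ by
    have hpos : 0 < 1 + σ ^ 2 := by positivity
    by_cases h : σ ^ 2 ≤ 2
    · have h1 : g σ ≤ 1 := by
        have h0 : 0 ≤ Real.smoothTransition (σ ^ 2 - 1) * (σ ^ 2 / (1 + σ ^ 2)) :=
          mul_nonneg (Real.smoothTransition.nonneg _) (by positivity)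
        rw [hg]
        linarith
      have h2 : (1 : ℝ) ≤ 3 * (1 + σ ^ 2)⁻¹ := by
        rw [← div_eq_mul_inv, le_div_iff₀ hpos]
        linarith
      exact h1.trans h2
    · rw [not_le] at h
      have hχ : Real.smoothTransition (σ ^ 2 - 1) = 1 :=
        Real.smoothTransition.one_of_one_le (by linarith)
      have hkey : 1 - σ ^ 2 / (1 + σ ^ 2) = (1 + σ ^ 2)⁻¹ := by
        field_simp
        ring
      have hinv : 0 < (1 + σ ^ 2)⁻¹ := by positivity
      simp only [hg]
      rw [hχ, one_mul, hkey]
      linarith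
  -- the primitive `f`
  set f : ℝ → ℝ := fun s ↦ ∫ σ in (0 : ℝ)..s, g σ with hf
  have f_deriv : ∀ s, HasDerivAt f (g s) s := fun s ↦
    (g_smooth.continuous.integral_hasStrictDerivAt 0 s).hasDerivAt
  have f_deriv' : deriv f = g := funext fun s ↦ (f_deriv s).deriv
  have f_smooth : ContDiff ℝ ∞ f := by
    refine contDiff_infty_iff_deriv.2 ⟨fun s ↦ (f_deriv s).differentiableAt, ?_⟩
    rw [f_deriv']
    exact g_smooth
  have f_mono : StrictMono f :=
    strictMono_of_deriv_pos fun s ↦ by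
      rw [f_deriv']
      exact g_pos s
  have f_id : ∀ s : ℝ, |s| ≤ 1 → f s = s := fun s hs ↦ by
    have h : EqOn g (fun _ ↦ (1 : ℝ)) (uIcc 0 s) := by
      intro σ hσ
      apply g_one
      have hσs : |σ| ≤ |s| := by
        rcases mem_uIcc.1 hσ with ⟨h0, h1⟩ | ⟨h0, h1⟩
        · rw [abs_of_nonneg h0, abs_of_nonneg (h0.trans h1)]
          exact h1
        · rw [abs_of_nonpos h1, abs_of_nonpos (h0.trans h1)]
          linarith
      exact hσs.trans hs
    simp only [hf]
    rw [intervalIntegral.integral_congr h, intervalIntegral.integral_const, smul_eq_mul, mul_one,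
      sub_zero]
  -- `0 ≤ ∫ₐᵇ g ≤ 3 (arctan b − arctan a)` for `a ≤ b`
  have f_bounds : ∀ a b : ℝ, a ≤ b →
      0 ≤ ∫ σ in a..b, g σ ∧ ∫ σ in a..b, g σ ≤ 3 * (arctan b - arctan a) := fun a b hab ↦ by
    have hint : ∀ u v : ℝ, IntervalIntegrable g MeasureTheory.volume u v :=
      fun u v ↦ g_smooth.continuous.intervalIntegrable u v
    refine ⟨intervalIntegral.integral_nonneg hab fun σ _ ↦ (g_pos σ).le, ?_⟩
    have hcont : Continuous fun σ : ℝ ↦ 3 * (1 + σ ^ 2)⁻¹ :=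
      continuous_const.mul ((continuous_const.add (continuous_id.pow 2)).inv₀ fun σ ↦
        (by positivity : (0 : ℝ) < 1 + σ ^ 2).ne')
    calc ∫ σ in a..b, g σ
        ≤ ∫ σ in a..b, 3 * (1 + σ ^ 2)⁻¹ :=
          intervalIntegral.integral_mono_on hab (hint a b) (hcont.intervalIntegrable a b)
            fun σ _ ↦ g_le σ
      _ = 3 * (arctan b - arctan a) := by
          rw [intervalIntegral.integral_const_mul]
          congr 1
          simp
  have f_bound : ∀ s : ℝ, |f s| < 5 := fun s ↦ by
    have hπ : 3 * (π / 2) < 5 := by nlinarith [pi_lt_d2]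
    rcases le_total 0 s with hs | hs
    · obtain ⟨h0, h1⟩ := f_bounds 0 s hs
      have hlt : arctan s < π / 2 := arctan_lt_pi_div_two s
      simp only [hf]
      rw [abs_of_nonneg h0]
      rw [arctan_zero, sub_zero] at h1
      nlinarith
    · obtain ⟨h0, h1⟩ := f_bounds s 0 hs
      have hlt : -(π / 2) < arctan s := neg_pi_div_two_lt_arctan s
      simp only [hf]
      rw [intervalIntegral.integral_symm, abs_neg, abs_of_nonneg h0]
      rw [arctan_zero, zero_sub] at h1
      nlinarith
  exact ⟨f, f_smooth, f_mono, f_id, f_bound⟩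

/-- **Smooth squash of the parameter line, identity near `0`.** For `δ > 0` there are `φ : ℝ¹ → ℝ¹` and
`δ' > 0` with `φ` of class `C^∞`, injective, `‖φ c‖ < δ` for all `c`, and `φ c = c` whenever `‖c‖ < δ'`
(namely `φ c = κ f (c₀/κ) e₀` with `κ = δ' = δ/5` and `f` from `exists_real_squash`). [folklore] -/
theorem exists_contDiff_squash_eqOn : ∀ {δ : ℝ}, 0 < δ → ∃ (φ : EuclideanSpace ℝ (Fin 1) → EuclideanSpace ℝ (Fin 1)) (δ' : ℝ), 0 < δ' ∧ ContDiff ℝ ((⊤ : ℕ∞) : WithTop ℕ∞) φ ∧ Function.Injective φ ∧ (∀ c, ‖φ c‖ < δ) ∧ ∀ c, ‖c‖ < δ' → φ c = c := by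
  intro δ hδ
  obtain ⟨f, f_smooth, f_mono, f_id, f_bound⟩ := exists_real_squash
  set κ : ℝ := δ / 5 with hκ
  have hκpos : 0 < κ := by positivity
  -- the rescaled one-dimensional squash
  set ψ : ℝ → ℝ := fun s ↦ κ * f (s / κ) with hψ
  have hψ_smooth : ContDiff ℝ ∞ ψ :=
    contDiff_const.mul (f_smooth.comp (contDiff_id.div_const κ))
  have hψ_inj : Injective ψ := by
    intro s t h
    have h' : f (s / κ) = f (t / κ) := mul_left_cancel₀ hκpos.ne' h
    have := f_mono.injective h'
    field_simp at this
    exact this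
  have hψ_lt : ∀ s, |ψ s| < δ := fun s ↦ by
    have h := f_bound (s / κ)
    simp only [hψ, abs_mul, abs_of_pos hκpos]
    calc κ * |f (s / κ)| < κ * 5 := mul_lt_mul_of_pos_left h hκpos
      _ = δ := by rw [hκ]; ring
  have hψ_id : ∀ s, |s| < κ → ψ s = s := fun s hs ↦ by
    have h1 : |s / κ| ≤ 1 := by
      rw [abs_div, abs_of_pos hκpos, div_le_one hκpos]
      exact hs.le
    simp only [hψ, f_id _ h1]
    field_simp
  -- single-coordinate identities in `ℝ¹`
  have hsingle : ∀ c : EuclideanSpace ℝ (Fin 1), EuclideanSpace.single 0 (c 0) = c := fun c ↦ by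
    ext i
    have hi : i = 0 := Subsingleton.elim i 0
    subst hi
    simp
  refine ⟨fun c ↦ EuclideanSpace.single 0 (ψ (c 0)), κ, hκpos, ?_, ?_, ?_, ?_⟩
  · -- smoothness, coordinatewise
    rw [contDiff_euclidean]
    intro i
    have hi : i = 0 := Subsingleton.elim i 0
    subst hi
    have hcoord : ContDiff ℝ ∞ fun c : EuclideanSpace ℝ (Fin 1) ↦ c 0 :=
      (EuclideanSpace.proj (𝕜 := ℝ) (0 : Fin 1)).contDiff
    have hfun : (fun c : EuclideanSpace ℝ (Fin 1) ↦
        (EuclideanSpace.single 0 (ψ (c 0)) : EuclideanSpace ℝ (Fin 1)) 0) = fun c ↦ ψ (c 0) := by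
      funext c
      simp
    rw [hfun]
    exact hψ_smooth.comp hcoord
  · -- injectivity
    intro c c' h
    have h0 : ψ (c 0) = ψ (c' 0) := by
      have := congrArg (fun v : EuclideanSpace ℝ (Fin 1) ↦ v 0) h
      simpa using this
    have h1 : c 0 = c' 0 := hψ_inj h0
    rw [← hsingle c, ← hsingle c', h1]
  · -- the bound
    intro c
    rw [PiLp.norm_single, Real.norm_eq_abs]
    exact hψ_lt (c 0)
  · -- identity near `0`
    intro c hc
    have h0 : |c 0| < κ := by
      have h1 : ‖c 0‖ ≤ ‖c‖ := PiLp.norm_apply_le c 0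
      rw [Real.norm_eq_abs] at h1
      exact lt_of_le_of_lt h1 hc
    show EuclideanSpace.single 0 (ψ (c 0)) = c
    rw [hψ_id (c 0) h0, hsingle c]

end Summit.FinalStateConjecture.FinalStateConjecture.Theorems.LaminatedThreshold.TailGluing

end
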